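import Literature.NumberTheory.Transcendental.SixExponentialsSeveralVariables
import Literature.NumberTheory.Transcendental.SixExponentialsSeveralVariablesBases
import HarnessLib

/-!
# Waldschmidt 1981: Théorème 2.1 from Théorème 1.1 (proof of §6 c))

Topic `Literature/NumberTheory/Transcendental`; sibling proof file of
`SixExponentialsSeveralVariables.lean`. It proves, sorry-free, the printed deduction
[Waldschmidt1981, §6 c), p. 111] of the matrix form of the linear subgroup theorem for tori
(`Waldschmidt1981.thm_2_1`, Invent. Math. 63 (1981), Théorème 2.1 — quoted by Roy 1995 as his
Theorem 1.2, tree fact `Literature.Barriers.Schanuel.waldschmidt1981_linearSubgroup_matrix`) from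
the subgroup form (`Waldschmidt1981.thm_1_1`, ibid. Théorème 1.1):

`thm_2_1_of_thm_1_1 : thm_1_1 → thm_2_1`.

Proof, following the source paragraph: given `M` (`d × ℓ`, rank `r`, entries logarithms of
algebraic numbers, `ℚ`-independent rows and columns, `r(d+ℓ) < dℓ`), factor `M = (⟨xᵢ, yⱼ⟩)`
through `ℂ^r` with the `yⱼ` spanning (`exists_eq_dotProduct_span_eq_top`, the surjections
`ξ, η`); the `xᵢ` and the `yⱼ` are `ℤ`-linearly independent because the rows and the columns of
`M` are `ℚ`-linearly independent ("le rang de `X` sur `ℤ` est égal à `d`"); Théorème 1.1 (with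
`n = r`) splits `X = X₁ ⊕ X₂`, `Y = Y₁ ⊕ Y₂`, `⟨X₁, Y₂⟩ = 0`; adapted unimodular bases
(`exists_adapted_basis`) give `P ∈ SL_d(ℤ)`, `Q ∈ SL_ℓ(ℤ)` with `PMQ = (⟨x'ᵢ, y'ⱼ⟩)`
(`map_mul_mul_map_eq_of_dotProduct`), whose upper-right `d₁ × (ℓ − ℓ₁)` block vanishes; as the
`y'ⱼ` span `ℂ^r`, the block `M₁` has rank `n₁ = dim_ℂ span X₁` (`rank_submatrix_eq_finrank_span`),
so `r₁ = n₁` and the inequalities `d₁/n₁ > d/r`, `ℓ₁d₁ ≤ n₁(ℓ₁ + d₁)` of Théorème 1.1 are the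
conclusions of Théorème 2.1 (`r₁ > 0` because `d₁ > 0` forces `X₁ ≠ 0`).

What remains for the discharge of `thm_2_1` (hence of Roy's Theorem 1.2) is `thm_1_1` itself:
Proposition 6.1 and Lemme 5.1 of the source, then Corollaire 4.2 (auxiliary function, Masser's
zero estimate, Liouville) — see the plan in `SixExponentialsSeveralVariables.lean`.

## References

* [Waldschmidt1981] M. Waldschmidt, *Transcendance et exponentielles en plusieurs variables*,
  Invent. Math. 63 (1981) 97–127, §6 c) "Démonstration du théorème 2.1" (p. 111).
-/

noncomputable section

open Complex Matrix Module

namespace Literature.NumberTheory.Transcendental.Waldschmidt1981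


/-- An integer combination, as a complex-linear combination. [folklore] -/
theorem sum_zsmul_eq_sum_cast_smul {ι : Type*} [Fintype ι] {r : ℕ} (c : ι → ℤ)
    (v : ι → Fin r → ℂ) : (∑ k, c k • v k) = ∑ k, ((c k : ℤ) : ℂ) • v k := by
  refine Finset.sum_congr rfl fun k _ => ?_
  rw [Int.cast_smul_eq_zsmul]

/-- The bilinear bookkeeping of §6 c): `PMQ = (⟨x'ᵢ, y'ⱼ⟩)` when `M = (⟨xₖ, yₘ⟩)`,
`x'ᵢ = ∑ₖ Pᵢₖ xₖ` and `y'ⱼ = ∑ₘ Qₘⱼ yₘ`. [cite: Waldschmidt1981, §6 c) (p. 111)] -/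
theorem map_mul_mul_map_eq_of_dotProduct {d l r : ℕ} (M : Matrix (Fin d) (Fin l) ℂ)
    (x : Fin d → Fin r → ℂ) (y : Fin l → Fin r → ℂ) (hM : ∀ i j, M i j = x i ⬝ᵥ y j)
    (P : Matrix (Fin d) (Fin d) ℤ) (Q : Matrix (Fin l) (Fin l) ℤ)
    (e : Fin d → Fin r → ℂ) (f : Fin l → Fin r → ℂ)
    (he : ∀ i, e i = ∑ k, P i k • x k) (hf : ∀ j, f j = ∑ m, Q m j • y m) :
    P.map (Int.castRingHom ℂ) * M * Q.map (Int.castRingHom ℂ) =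
      Matrix.of fun i j => e i ⬝ᵥ f j := by
  ext i j
  rw [Matrix.of_apply, he, hf, sum_zsmul_eq_sum_cast_smul, sum_zsmul_eq_sum_cast_smul,
    sum_dotProduct]
  simp only [dotProduct_sum, smul_dotProduct, dotProduct_smul, smul_eq_mul, Matrix.mul_apply,
    Matrix.map_apply, eq_intCast, Finset.sum_mul]
  rw [Finset.sum_comm]
  refine Finset.sum_congr rfl fun k _ => Finset.sum_congr rfl fun m _ => ?_
  rw [hM]
  ring

/-- **Théorème 2.1 from Théorème 1.1** (the proof of §6 c) of the source). Given a `d × ℓ`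
matrix `M` of logarithms of algebraic numbers of rank `r` with `ℚ`-linearly independent rows
and columns and `r(d + ℓ) < dℓ`: factor `M = (⟨xᵢ, yⱼ⟩)` through `ℂ^r` with the `yⱼ`
spanning (`exists_eq_dotProduct_span_eq_top`); the `xᵢ` (resp. `yⱼ`) are `ℤ`-linearly
independent because the rows (resp. columns) are; Théorème 1.1 splits `X = X₁ ⊕ X₂`,
`Y = Y₁ ⊕ Y₂` with `⟨X₁, Y₂⟩ = 0`; adapted unimodular bases (`exists_adapted_basis`) give
`P, Q` with `PMQ = (⟨x'ᵢ, y'ⱼ⟩)` block lower-triangular, and since the `y'ⱼ` span `ℂ^r` the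
block `M₁` has rank `n₁ = dim span X₁` (`rank_submatrix_eq_finrank_span`), so that the
inequalities of Théorème 1.1 are those of Théorème 2.1. [cite: Waldschmidt1981, §6 c) (p. 111)] -/
theorem thm_2_1_of_thm_1_1 (h11 : thm_1_1) : thm_2_1 := by
  intro d l M halg hrows hcols hr
  classical
  -- `d, l ≥ 1`
  have hd : 0 < d := by
    rcases Nat.eq_zero_or_pos d with h0 | h0
    · subst h0; simp at hr
    · exact h0
  have hl : 0 < l := by
    rcases Nat.eq_zero_or_pos l with h0 | h0
    · subst h0; simp at hr
    · exact h0
  -- Step 1: rank factorisation `M = (⟨xᵢ, yⱼ⟩)` through `ℂ^r`, the `yⱼ` spanning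
  set r := M.rank with hrdef
  obtain ⟨x, y, hxy, hyspan⟩ := exists_eq_dotProduct_span_eq_top M
  -- Step 2: `x` and `y` are `ℤ`-linearly independent
  have hinj : Function.Injective fun n : ℤ => n • (1 : ℚ) := by
    intro a b hab
    simpa using hab
  have hxli : LinearIndependent ℤ x := by
    have hrowsZ : LinearIndependent ℤ (fun i => M i) := hrows.restrict_scalars hinj
    let g : (Fin r → ℂ) →ₗ[ℤ] (Fin l → ℂ) := ((Matrix.of y).mulVecLin).restrictScalars ℤ
    have hg : (fun i => M i) = g ∘ x := by
      funext i; ext j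
      simp only [g, Function.comp_apply, LinearMap.coe_restrictScalars, Matrix.mulVecLin_apply,
        Matrix.mulVec, Matrix.of_apply]
      rw [hxy, dotProduct_comm]
    rw [hg] at hrowsZ
    exact LinearIndependent.of_comp g hrowsZ
  have hyli : LinearIndependent ℤ y := by
    have hcolsZ : LinearIndependent ℤ (fun j => M.transpose j) := hcols.restrict_scalars hinj
    let g : (Fin r → ℂ) →ₗ[ℤ] (Fin d → ℂ) := ((Matrix.of x).mulVecLin).restrictScalars ℤ
    have hg : (fun j => M.transpose j) = g ∘ y := by
      funext j; ext i
      simp only [g, Function.comp_apply, LinearMap.coe_restrictScalars, Matrix.mulVecLin_apply,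
        Matrix.mulVec, Matrix.of_apply, Matrix.transpose_apply]
      rw [hxy]
    rw [hg] at hcolsZ
    exact LinearIndependent.of_comp g hcolsZ
  -- Step 3: Théorème 1.1 with `n = r`
  have hnum : r * (l + d) < l * d := by
    have : r * (d + l) < d * l := hr
    rwa [Nat.add_comm, Nat.mul_comm d l] at this
  have halg' : ∀ i j, IsAlgebraic ℚ (cexp (x i ⬝ᵥ y j)) := fun i j => hxy i j ▸ halg i j
  obtain ⟨X₁, X₂, Y₁, Y₂, hXsup, hXinf, hYsup, hYinf, horth, hlt, hle⟩ :=
    h11 x y hxli hyli hnum halg'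
  -- Step 4: adapted unimodular bases of `X` and `Y`
  obtain ⟨d₁, hd₁, e, P, hPdet, he, hd₁rank, heA, heB, hAspan, hxspan⟩ :=
    exists_adapted_basis hd hxli hXsup hXinf
  obtain ⟨l₁, hl₁, f, Q', hQdet, hf, hl₁rank, hfA, hfB, -, hyspan'⟩ :=
    exists_adapted_basis hl hyli hYsup hYinf
  -- `Q` acts on the right: transpose
  let Q : Matrix (Fin l) (Fin l) ℤ := Q'.transpose
  have hQdet' : Q.det = 1 := by rw [Matrix.det_transpose]; exact hQdet
  have hf' : ∀ j, f j = ∑ m, Q m j • y m := fun j => by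
    simpa only [Q, Matrix.transpose_apply] using hf j
  have hPMQ := map_mul_mul_map_eq_of_dotProduct M x y hxy P Q e f he hf'
  -- the new `y'ⱼ` still span `ℂ^r`
  have hfspan : Submodule.span ℂ (Set.range f) = ⊤ := by
    rw [eq_top_iff, ← hyspan]
    refine Submodule.span_le.mpr ?_
    rintro _ ⟨m, rfl⟩
    exact Submodule.span_le_restrictScalars ℤ ℂ _ (hyspan' m)
  -- Step 5: the zero block and the rank of the block `M₁`
  set n₁ := Module.finrank ℂ (Submodule.span ℂ (X₁ : Set (Fin r → ℂ))) with hn₁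
  have hzero : ∀ (i : Fin d) (j : Fin l), (i : ℕ) < d₁ → l₁ ≤ (j : ℕ) → e i ⬝ᵥ f j = 0 :=
    fun i j hi hj => horth _ (heA i hi) _ (hfB j hj)
  have hspan_e : Submodule.span ℂ (Set.range fun i : Fin d₁ => e (Fin.castLE hd₁ i)) =
      Submodule.span ℂ (X₁ : Set (Fin r → ℂ)) := by
    apply le_antisymm
    · refine Submodule.span_mono ?_
      rintro _ ⟨i, rfl⟩
      exact heA _ (by simp)
    · rw [Submodule.span_le]
      intro u hu
      exact Submodule.span_le_restrictScalars ℤ ℂ _ (hAspan hu)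
  have hrank₁ : ((Matrix.of fun i j => e i ⬝ᵥ f j).submatrix (Fin.castLE hd₁)
      (Fin.castLE hl₁)).rank = n₁ := by
    rw [rank_submatrix_eq_finrank_span e f hfspan hd₁ hl₁ hzero, hspan_e]
  -- Step 6: the numerology of Théorème 1.1 is that of Théorème 2.1 (`r₁ = n₁`)
  rw [hd₁rank] at hlt hle
  rw [hl₁rank] at hle
  have hn₁pos : 0 < n₁ := by
    obtain ⟨hd₁pos, -⟩ := pos_of_mul_lt_mul hlt
    have hX₁ : ∃ u ∈ X₁, u ≠ 0 := by
      by_contra hcon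
      push Not at hcon
      have hbot : X₁ = ⊥ := (Submodule.eq_bot_iff X₁).mpr hcon
      rw [hbot, finrank_bot] at hd₁rank
      omega
    obtain ⟨u, hu, hu0⟩ := hX₁
    refine Module.finrank_pos_iff_exists_ne_zero.mpr ⟨⟨u, Submodule.subset_span hu⟩, ?_⟩
    simpa using hu0
  refine ⟨P, Q, hPdet, hQdet', d₁, l₁, n₁, hd₁, hl₁, hn₁pos, hlt, hle, ?_, ?_⟩
  · intro i j hi hj
    rw [hPMQ, Matrix.of_apply]
    exact hzero i j hi hj
  · rw [hPMQ]
    exact hrank₁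

end Literature.NumberTheory.Transcendental.Waldschmidt1981

end
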